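import Summits.MatrixMultiplication.MatrixMultiplication.Theses.SaturationLadder
import Summits.MatrixMultiplication.MatrixMultiplication.Theorems.SaturationLadderOnsetContinuum
import Summits.MatrixMultiplication.MatrixMultiplication.Theorems.SaturationLadderExpSaturation
import Summits.MatrixMultiplication.MatrixMultiplication.Theorems.FarEdgeDescentCornerFold

/-!
# The `E₂`-chord ladder of route `SaturationLadder` (items stmt-MatrixMultiplication-29474
`TailDescentTwo`, 29475 `SquareFromTwo`, 23739 `FiniteSaturation`; decomposition cell `decomp-mm`,
lens 1 «grading / quantitative ladder», generation 18)

PROOF, 0 sorry, no new definitions, no new named facts.  Write `T(t,r)` for exact tightness of the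
information bound at the thin shape `⟨n, n^t, n^r⟩`, `T(t,r) : ω(1,t,r) ≤ 1 + r` (`0 ≤ t ≤ 1 ≤ r`), and
`E_a : ω(1,a,1) = a + 1` for far tightness at the real length `a ≥ 1` (`E_1 ⟺ ω = 2`, `E_2` is the hinge
between the cut's pieces `TailDescentTwo : FiniteSaturation⁺ → E_2` and `SquareFromTwo : E_2 → ω = 2`).

## The object: chords of the exact-tight region through `(0, 1)`

* §1 The exact-tight region `S = {(t,r) : T(t,r)}` is CONVEX (Lotti–Romani convexity of `ω(·,·,·)`,
  `tight_convexComb`), up-closed in `r` (`tight_mono_len`) and down-closed along chords from `(0,1)`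
  (`chordRung_anti`); `(0,1) ∈ S` (`ω(1,0,1) = 2`).
* §2 CHORD FORM OF THE FAR RUNGS (`far_iff_forall_chord`): for every real `a ≥ 1`,
  `E_a ⟺ ∀ t ∈ [0,1), T(t, 1 + (a−1)t)` — far tightness at length `a` is exactly tightness along the
  chord from `(0,1)` to `(1,a)` (→ convexity; ← subadditivity `ω(1,1,a) ≤ ω(1,t,1+(a−1)t) + a(1−t)` and
  `t ↑ 1`).  Slope `σ = a − 1`: `σ = 0` is `ω = 2` (`summit_iff_forall_thin_one`), `σ = 1` is `E_2`
  (`doubleSquare_iff_forall_chord`: `ω(1,2,1) = 3 ⟺ ∀ t < 1, ω(1,t,1+t) = 2 + t`), `∃ σ` is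
  `FiniteSaturation` (`finiteSaturation_iff_exists_slope`); the cut items read
  `TailDescentTwo ⟺ (some slope ⟹ slope 1)` and `SquareFromTwo ⟺ (slope 1 ⟹ slope 0)`
  (`tailDescentTwo_iff_slopes`, `squareFromTwo_iff_slopes`).  Compared with the generation-17 horizontal
  form `E_a ⟺ ∀ t < 1, T(t, a)` (`SaturationLadderOnsetContinuum.far_iff_forall_thin`) the chord rungs
  `R_t := T(t, 1+t)` are THINNER (`1 + t < 2`): each is necessary for `ω = 2` (`chord_of_summit`), jointly
  they are `E_2`, and each single rung is a thin-shape exact-tightness statement of the kind this route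
  certifies constructively.
* §3 ANCHORED CHORDS (`chord_of_anchor`, `chordSlope_of_anchor`, `chordRung_of_anchor`): an anchor
  `ω(1,α',1) ≤ 2` and ONE exact point `T(t₂,r₂)` with `t₂ > α'` give, by convexity,
  `T(t, 1 + (r₂−1)(t−α')/(t₂−α'))` on `[α', t₂]`, hence the chord rung `R_t` for every
  `t ≤ α'(r₂−1)/((r₂−1) − (t₂−α'))` (anchored slope `(r₂−1)/(t₂−α')`), and similarly for every slope `σ`.
* §4 A NEW EXACT POINT: `T(1/2, 9/2)`, i.e. `ω(2,1,9) = 11` — `⟨n², n, n⁹⟩` is exactly tight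
  (`omegaRect_two_one_nine`) — the member `(q,k,c) = (11,1,9)` of the lineage's X-perfect first-power `CW_q`
  family `SaturationLadderExpSaturation.tight_cwFamily`, whose entropy condition at `q = 11` is the integer
  inequality `3³·10¹⁰ ≤ 11¹¹` (`entropyCondition_eleven`; it fails at `q = 10`: `10¹⁰ < 27·9⁹`).
* §5 THE FRONTIER (`chordRung_frontier`): under the named fact `vxxz2024_alpha_ge` (`α ≥ 0.321334`,
  VXXZ 2024) the rungs `R_t` hold for every `0 ≤ t ≤ 0.3386` (anchor `(0.321334, 1)`, point `(1/2, 9/2)`,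
  slope `19.59`; exact supremum of the method `0.338619…`); corollary `ω(3,1,4) = 7` (`⟨n³,n,n⁴⟩` exactly
  tight, `omegaRect_three_one_four`).  The grades `t ∈ (0.3386, 0.3828)` are OPEN and
  CONSEQUENCE-FREE: the prices of `R_t` (§6, `chordRung_prices`, lens 2's `tight_fold` / `omega_le_tight`
  cited) are `α ≥ 2t/(2+t)` (`< 0.321334` iff `t < 0.38284`; `alphaPrice_top_lt_record`) and
  `ω ≤ 3(2+t)/(2+2t)` (`< 2.371552` only for `t > 0.7216`); the top grades `t → 1` are `E_2` itself.
  Next grade `R_{0.35}`: attackable in class iff some exact certificate has anchored slope `≤ 12.2`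
  (level-1 X-perfect `CW_q` designs reach `≈ 13.7` at `q = 8`, i.e. `t ≤ 0.3466` — cell instrument ask).

This is a different object from lens 5's `CharacteristicContinuityTransferThreshold.chordRungs` (chords of
the VALUE profile `a ↦ ω(1,a,1)` from `(0,2)`, top rung the transfer residual `K′`): here the chords live in
the SHAPE plane `(t,r)` of exact tightness, carry no `ω`-values, and their top rung is the onset statement `E_2`.

References: Lotti–Romani 1983 §1–§2 (homogeneity, subadditivity, convexity; the question whether `e(k) = 0`
for some finite `k`) [LottiRomani1983]; Huang–Pan 1998 §2 (2.5)–(2.8) (information bound, `ω(1,2,1)`)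
[HuangPan1998]; Coppersmith–Winograd 1990 §6 [CoppersmithWinograd1990]; Le Gall 2014 App. A [LeGall2014];
Alman–Duan–Vassilevska Williams–Xu–Xu–Zhou 2025 Thm. 3.2 [AlmanDuanVassilevskaWilliamsXuXuZhou2025];
Vassilevska Williams–Xu–Xu–Zhou 2024 (`α ≥ 0.321334`) [VassilevskaWilliamsXuXuZhou2024]; Le Gall 2012 §1
(`α`) [LeGall2012]; Christandl–Le Gall–Lysikov–Zuiddam (barriers for rectangular MM)
[ChristandlLeGallLysikovZuiddam2025].
-/

set_option linter.dupNamespace false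
-- (single-conjunct summit: the namespace repeats `MatrixMultiplication`)

noncomputable section

namespace Summit.MatrixMultiplication.MatrixMultiplication.Theorems.SaturationLadderChordLadder

open Literature.Computability.AlgebraicComplexity
open Summit.MatrixMultiplication.MatrixMultiplication.Theses.SaturationLadder
  (TailDescentTwo SquareFromTwo FiniteSaturation)
open SaturationLadderOnsetContinuum (far_iff_le far_one_iff far_mono finiteSaturation_iff_real)
open SaturationLadderExpSaturation (tight_cwFamily)
open FarEdgeDescentCornerFold (tight_fold omega_le_tight)

/-! ## §1 The exact-tight region is convex, up-closed in the length, down-closed along chords -/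

/-- **Up-closure in the length**: `T(t,r) → T(t,r')` for `r ≤ r'` (pad the long factor).
[cite: LottiRomani1983, §1 (p. 173)] -/
theorem tight_mono_len {t r r' : ℝ} (hrr : r ≤ r') (h : omegaRect ℂ 1 t r ≤ 1 + r) :
    omegaRect ℂ 1 t r' ≤ 1 + r' := by
  have h1 := omegaRect_add_le_add_pos ℂ 1 t r 0 0 (r' - r)
  have e : r + (r' - r) = r' := by ring
  simp only [add_zero, e, max_self, zero_add, max_eq_left (sub_nonneg.2 hrr)] at h1
  linarith

/-- **Convexity of the exact-tight region**: `T(t₁,r₁) ∧ T(t₂,r₂) → T(a t₁ + b t₂, a r₁ + b r₂)` for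
`a, b ≥ 0`, `a + b = 1` (Lotti–Romani: `ω` is convex on the orthant, `1 + r` is affine).
[cite: LottiRomani1983, §1 (p. 173)] -/
theorem tight_convexComb {t₁ r₁ t₂ r₂ a b : ℝ} (ht₁ : 0 ≤ t₁) (hr₁ : 0 ≤ r₁) (ht₂ : 0 ≤ t₂)
    (hr₂ : 0 ≤ r₂) (ha : 0 ≤ a) (hb : 0 ≤ b) (hab : a + b = 1)
    (h₁ : omegaRect ℂ 1 t₁ r₁ ≤ 1 + r₁) (h₂ : omegaRect ℂ 1 t₂ r₂ ≤ 1 + r₂) :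
    omegaRect ℂ 1 (a * t₁ + b * t₂) (a * r₁ + b * r₂) ≤ 1 + (a * r₁ + b * r₂) := by
  have h := LottiRomani1983_convexComb_le ℂ zero_le_one ht₁ hr₁ zero_le_one ht₂ hr₂ ha hb
  rw [show a * 1 + b * 1 = (1 : ℝ) by rw [mul_one, mul_one, hab]] at h
  calc omegaRect ℂ 1 (a * t₁ + b * t₂) (a * r₁ + b * r₂)
      ≤ a * omegaRect ℂ 1 t₁ r₁ + b * omegaRect ℂ 1 t₂ r₂ := h
    _ ≤ a * (1 + r₁) + b * (1 + r₂) :=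
        add_le_add (mul_le_mul_of_nonneg_left h₁ ha) (mul_le_mul_of_nonneg_left h₂ hb)
    _ = 1 + (a * r₁ + b * r₂) := by linear_combination hab

/-- **Inside the `α`-zone every chord is tight**: `ω(1,t,1) ≤ 2 → T(t, 1 + σt)` (`σ, t ≥ 0`; pad).
[cite: LeGall2012, §1] -/
theorem chord_of_thin_one {t σ : ℝ} (ht : 0 ≤ t) (hσ : 0 ≤ σ) (h : omegaRect ℂ 1 t 1 ≤ 2) :
    omegaRect ℂ 1 t (1 + σ * t) ≤ 2 + σ * t := by
  have h1 : omegaRect ℂ 1 t 1 ≤ 1 + 1 := by linarith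
  have h2 := tight_mono_len (by nlinarith : (1 : ℝ) ≤ 1 + σ * t) h1
  linarith

/-- **Down-closure along the chord**: `R_t → R_{t'}` for `0 ≤ t' ≤ t` (`R_t : ω(1,t,1+t) ≤ 2 + t`; convex
combination with the corner `(0,1)`, `ω(1,0,1) = 2`). [cite: LottiRomani1983, §1 (p. 173)] -/
theorem chordRung_anti {t t' : ℝ} (ht' : 0 ≤ t') (htt : t' ≤ t) (h : omegaRect ℂ 1 t (1 + t) ≤ 2 + t) :
    omegaRect ℂ 1 t' (1 + t') ≤ 2 + t' := by
  rcases eq_or_lt_of_le (ht'.trans htt) with ht0 | ht0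
  · have e : t' = 0 := le_antisymm (ht0 ▸ htt) ht'
    rw [e, add_zero, add_zero, omegaRect_one_zero_one ℂ]
  have h0 : omegaRect ℂ 1 0 1 ≤ 1 + 1 := by rw [omegaRect_one_zero_one ℂ]; norm_num
  have h' : omegaRect ℂ 1 t (1 + t) ≤ 1 + (1 + t) := by linarith
  have hl0 : 0 ≤ t' / t := div_nonneg ht' ht0.le
  have hl1 : t' / t ≤ 1 := (div_le_one ht0).2 htt
  have hc := tight_convexComb le_rfl zero_le_one ht0.le (by linarith) (by linarith : 0 ≤ 1 - t' / t) hl0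
    (by ring : (1 - t' / t) + t' / t = 1) h0 h'
  have ht0' : t ≠ 0 := ht0.ne'
  have e1 : (1 - t' / t) * 0 + t' / t * t = t' := by field_simp; ring
  have e2 : (1 - t' / t) * 1 + t' / t * (1 + t) = 1 + t' := by field_simp; ring
  rw [e1, e2] at hc
  linarith

/-! ## §2 Chord form of the far rungs, and the cut in slopes -/

/-- **`E_a ⟺ ∀ t ∈ [0,1), T(t, 1 + (a−1)t)`** (`a ≥ 1`): far tightness at the real length `a` is tightness
along the whole chord from `(0,1)` to `(1,a)` of the shape plane.  `→`: convexity between `ω(1,0,1) = 2` and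
`ω(1,1,a) = 1 + a`; `←`: `ω(1,1,a) ≤ ω(1,t,1+(a−1)t) + (1−t) + (a−1)(1−t) ≤ a + 1 + (1−t)`, `t ↑ 1`.
[cite: LottiRomani1983, §1 (p. 173)] [cite: HuangPan1998, §2 eq. (2.8) (p. 262)] -/
theorem far_iff_forall_chord {a : ℝ} (ha : 1 ≤ a) :
    omegaRect ℂ 1 a 1 = a + 1 ↔
      ∀ t : ℝ, 0 ≤ t → t < 1 → omegaRect ℂ 1 t (1 + (a - 1) * t) ≤ 2 + (a - 1) * t := by
  constructor
  · intro h t ht0 ht1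
    have hfar : omegaRect ℂ 1 1 a ≤ 1 + a := by rw [omegaRect_swap₂₃ ℂ 1 1 a, h, add_comm]
    have h0 : omegaRect ℂ 1 0 1 ≤ 1 + 1 := by rw [omegaRect_one_zero_one ℂ]; norm_num
    have hc := tight_convexComb le_rfl zero_le_one zero_le_one (by linarith) (by linarith : 0 ≤ 1 - t)
      ht0 (by ring : (1 - t) + t = 1) h0 hfar
    have e1 : (1 - t) * 0 + t * 1 = t := by ring
    have e2 : (1 - t) * 1 + t * a = 1 + (a - 1) * t := by ring
    rw [e1, e2] at hc
    linarith
  · intro h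
    rw [far_iff_le]
    refine le_of_forall_pos_le_add fun ε hε => ?_
    have ht0 : 0 ≤ max 0 (1 - ε) := le_max_left _ _
    have ht1 : max 0 (1 - ε) < 1 := max_lt one_pos (by linarith)
    have htε : 1 - ε ≤ max 0 (1 - ε) := le_max_right _ _
    have hch := h _ ht0 ht1
    have hsub := omegaRect_add_le_add_pos ℂ 1 (max 0 (1 - ε)) (1 + (a - 1) * max 0 (1 - ε)) 0
      (1 - max 0 (1 - ε)) ((a - 1) * (1 - max 0 (1 - ε)))
    have e1 : max 0 (1 - ε) + (1 - max 0 (1 - ε)) = 1 := by ring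
    have e2 : 1 + (a - 1) * max 0 (1 - ε) + (a - 1) * (1 - max 0 (1 - ε)) = a := by ring
    rw [add_zero, e1, e2, max_self, max_eq_left (by linarith : (0 : ℝ) ≤ 1 - max 0 (1 - ε)),
      max_eq_left (by nlinarith : (0 : ℝ) ≤ (a - 1) * (1 - max 0 (1 - ε))), zero_add] at hsub
    rw [omegaRect_swap₂₃ ℂ 1 a 1]
    nlinarith

/-- **`E_2 ⟺ ∀ t ∈ [0,1), ω(1,t,1+t) = 2 + t`**: the double square `⟨n,n²,n⟩` is exactly tight iff every
shape `⟨n, n^t, n^{1+t}⟩` is — the chord ladder `R_t`, whose conjunction is the hinge `E_2` of the cut.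
[cite: HuangPan1998, §2 (2.5)–(2.8) (p. 262)] [cite: LottiRomani1983, §1 (p. 173)] -/
theorem doubleSquare_iff_forall_chord :
    omegaRect ℂ 1 2 1 = 3 ↔ ∀ t : ℝ, 0 ≤ t → t < 1 → omegaRect ℂ 1 t (1 + t) ≤ 2 + t := by
  have h := far_iff_forall_chord (a := 2) (by norm_num)
  rw [show (2 : ℝ) - 1 = 1 by norm_num, show (2 : ℝ) + 1 = 3 by norm_num] at h
  simp only [one_mul] at h
  exact h

/-- **Slope `0` is the summit**: `ω = 2 ⟺ ∀ t ∈ [0,1), ω(1,t,1) ≤ 2` (`⟺ α = 1`). [cite: LeGall2012, §1] -/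
theorem summit_iff_forall_thin_one :
    _root_.MatrixMultiplication ↔ ∀ t : ℝ, 0 ≤ t → t < 1 → omegaRect ℂ 1 t 1 ≤ 2 := by
  rw [← far_one_iff]
  have h := far_iff_forall_chord (a := 1) le_rfl
  simp only [sub_self, zero_mul, add_zero] at h
  exact h

/-- **`FiniteSaturation ⟺ the saturation curve has a LINEAR majorant through `(0,1)`**:
`∃ σ ≥ 0, ∀ t ∈ [0,1), T(t, 1 + σt)`. [cite: LottiRomani1983, §2 (p. 174)] -/
theorem finiteSaturation_iff_exists_slope :
    FiniteSaturation ↔ ∃ σ : ℝ, 0 ≤ σ ∧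
      ∀ t : ℝ, 0 ≤ t → t < 1 → omegaRect ℂ 1 t (1 + σ * t) ≤ 2 + σ * t := by
  rw [finiteSaturation_iff_real]
  constructor
  · rintro ⟨a, ha, hE⟩
    exact ⟨a - 1, by linarith, (far_iff_forall_chord ha).1 hE⟩
  · rintro ⟨σ, hσ, h⟩
    refine ⟨1 + σ, by linarith, (far_iff_forall_chord (by linarith)).2 ?_⟩
    have e : (1 : ℝ) + σ - 1 = σ := by ring
    rw [e]
    exact h

/-- **Item 29474 in slopes**: `TailDescentTwo ⟺ (some slope is tight ⟹ slope 1 is tight)`.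
[cite: LottiRomani1983, §2 (p. 174)] -/
theorem tailDescentTwo_iff_slopes :
    TailDescentTwo ↔
      ((∃ σ : ℝ, 0 ≤ σ ∧ ∀ t : ℝ, 0 ≤ t → t < 1 → omegaRect ℂ 1 t (1 + σ * t) ≤ 2 + σ * t) →
        ∀ t : ℝ, 0 ≤ t → t < 1 → omegaRect ℂ 1 t (1 + t) ≤ 2 + t) := by
  rw [← finiteSaturation_iff_exists_slope, ← doubleSquare_iff_forall_chord]
  unfold TailDescentTwo FiniteSaturation
  constructor
  · rintro h ⟨k, hk, hE⟩
    rcases (show 3 ≤ k ∨ k = 2 by omega) with hk3 | rfl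
    · exact h ⟨k, hk3, hE⟩
    · push_cast at hE
      linarith [hE]
  · rintro h ⟨k, hk, hE⟩
    exact h ⟨k, by omega, hE⟩

/-- **Item 29475 (declared residual) in slopes**: `SquareFromTwo ⟺ (slope 1 is tight ⟹ slope 0 is tight)`.
[cite: HuangPan1998, §2 (p. 262)] -/
theorem squareFromTwo_iff_slopes :
    SquareFromTwo ↔
      ((∀ t : ℝ, 0 ≤ t → t < 1 → omegaRect ℂ 1 t (1 + t) ≤ 2 + t) →
        ∀ t : ℝ, 0 ≤ t → t < 1 → omegaRect ℂ 1 t 1 ≤ 2) := by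
  rw [← doubleSquare_iff_forall_chord, ← summit_iff_forall_thin_one]
  exact Iff.rfl

/-- **Every chord rung is necessary**: `ω = 2 → T(t, 1 + σt)` for all `σ ≥ 0`, `t ∈ [0,1]` (`α = 1`).
[cite: LeGall2012, §1] -/
theorem chord_of_summit (hS : _root_.MatrixMultiplication) {σ t : ℝ} (hσ : 0 ≤ σ) (ht0 : 0 ≤ t)
    (ht1 : t ≤ 1) : omegaRect ℂ 1 t (1 + σ * t) ≤ 2 + σ * t := by
  have hα : dualExponentAlpha ℂ = 1 :=
    (dualExponentAlpha_eq_one_iff ℂ).2 (_root_.MatrixMultiplication_iff.1 hS)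
  have ht : t ≤ dualExponentAlpha ℂ := by rw [hα]; exact ht1
  exact chord_of_thin_one ht0 hσ (omegaRect_eq_two_of_le_dualExponentAlpha ℂ ht).le

/-! ## §3 Anchored chords: one exact point beyond an `α`-anchor -/

/-- **Anchored chord**: `ω(1,α',1) ≤ 2` and `T(t₂,r₂)` with `α' < t₂`, `r₂ ≥ 1` give
`T(t, 1 + (r₂−1)(t−α')/(t₂−α'))` for every `t ∈ [α', t₂]` (convexity between `(α',1)` and `(t₂,r₂)`).
[cite: LottiRomani1983, §1 (p. 173)] -/
theorem chord_of_anchor {α' t₂ r₂ t : ℝ} (hα' : 0 ≤ α') (hanchor : omegaRect ℂ 1 α' 1 ≤ 2)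
    (hlt : α' < t₂) (hr₂ : 1 ≤ r₂) (h₂ : omegaRect ℂ 1 t₂ r₂ ≤ 1 + r₂) (hαt : α' ≤ t) (htt₂ : t ≤ t₂) :
    omegaRect ℂ 1 t (1 + (r₂ - 1) * (t - α') / (t₂ - α')) ≤ 2 + (r₂ - 1) * (t - α') / (t₂ - α') := by
  have hd : 0 < t₂ - α' := sub_pos.2 hlt
  have hd0 : t₂ - α' ≠ 0 := hd.ne'
  have hl0 : 0 ≤ (t - α') / (t₂ - α') := div_nonneg (sub_nonneg.2 hαt) hd.le
  have hl1 : (t - α') / (t₂ - α') ≤ 1 := (div_le_one hd).2 (by linarith)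
  have h1 : omegaRect ℂ 1 α' 1 ≤ 1 + 1 := by linarith
  have hc := tight_convexComb hα' zero_le_one (by linarith) (by linarith)
    (by linarith : 0 ≤ 1 - (t - α') / (t₂ - α')) hl0
    (by ring : (1 - (t - α') / (t₂ - α')) + (t - α') / (t₂ - α') = 1) h1 h₂
  have e1 : (1 - (t - α') / (t₂ - α')) * α' + (t - α') / (t₂ - α') * t₂ = t := by
    field_simp; ring
  have e2 : (1 - (t - α') / (t₂ - α')) * 1 + (t - α') / (t₂ - α') * r₂ =
      1 + (r₂ - 1) * (t - α') / (t₂ - α') := by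
    field_simp; ring
  rw [e1, e2] at hc
  linarith

/-- **Chords of slope `σ` from an anchored point**: under the hypotheses of `chord_of_anchor`, if the
anchored slope fits under the chord of slope `σ ≥ 0` through `(0,1)`, `(r₂−1)(t−α') ≤ σ t (t₂−α')`, then
`T(t, 1 + σt)`. [cite: LottiRomani1983, §1 (p. 173)] -/
theorem chordSlope_of_anchor {α' t₂ r₂ t σ : ℝ} (hα' : 0 ≤ α') (hanchor : omegaRect ℂ 1 α' 1 ≤ 2)
    (hlt : α' < t₂) (hr₂ : 1 ≤ r₂) (h₂ : omegaRect ℂ 1 t₂ r₂ ≤ 1 + r₂) (hαt : α' ≤ t) (htt₂ : t ≤ t₂)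
    (hslope : (r₂ - 1) * (t - α') ≤ σ * t * (t₂ - α')) :
    omegaRect ℂ 1 t (1 + σ * t) ≤ 2 + σ * t := by
  have hd : 0 < t₂ - α' := sub_pos.2 hlt
  have hc := chord_of_anchor hα' hanchor hlt hr₂ h₂ hαt htt₂
  have hq : (r₂ - 1) * (t - α') / (t₂ - α') ≤ σ * t := (div_le_iff₀ hd).2 hslope
  have hc' : omegaRect ℂ 1 t (1 + (r₂ - 1) * (t - α') / (t₂ - α')) ≤
      1 + (1 + (r₂ - 1) * (t - α') / (t₂ - α')) := by linarith
  have h3 := tight_mono_len (by linarith : 1 + (r₂ - 1) * (t - α') / (t₂ - α') ≤ 1 + σ * t) hc'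
  linarith

/-- **The chord rung from an anchored point** (`σ = 1`): `(r₂−1)(t−α') ≤ t (t₂−α')` gives
`R_t : ω(1,t,1+t) ≤ 2 + t`; i.e. `R_t` holds for all `t ≤ α'(r₂−1)/((r₂−1) − (t₂−α'))`.
[cite: LottiRomani1983, §1 (p. 173)] -/
theorem chordRung_of_anchor {α' t₂ r₂ t : ℝ} (hα' : 0 ≤ α') (hanchor : omegaRect ℂ 1 α' 1 ≤ 2)
    (hlt : α' < t₂) (hr₂ : 1 ≤ r₂) (h₂ : omegaRect ℂ 1 t₂ r₂ ≤ 1 + r₂) (hαt : α' ≤ t) (htt₂ : t ≤ t₂)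
    (hslope : (r₂ - 1) * (t - α') ≤ t * (t₂ - α')) :
    omegaRect ℂ 1 t (1 + t) ≤ 2 + t := by
  have h := chordSlope_of_anchor (σ := 1) hα' hanchor hlt hr₂ h₂ hαt htt₂ (by linarith)
  simpa only [one_mul] using h

/-! ## §4 A new exact point: `T(1/2, 9/2)`, i.e. `ω(2,1,9) = 11`, from `CW_11` -/

/-- **The entropy condition of the X-perfect `CW_q` family at `(q,k) = (11,1)`**:
`2η(1/13) + η(11/13) ≤ h(3/13)`, equivalently `3 log 3 + 10 log 10 ≤ 11 log 11`, i.e. `27·10¹⁰ ≤ 11¹¹`.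
[folklore] -/
theorem entropyCondition_eleven :
    2 * Real.negMulLog (1 / (((11 : ℕ) : ℝ) + 2)) + Real.negMulLog (1 - 2 * (1 / (((11 : ℕ) : ℝ) + 2))) ≤
      Real.binEntropy ((2 * ((1 : ℕ) : ℝ) + 1) / ((((11 : ℕ) : ℝ) + 2) * ((1 : ℕ) : ℝ))) := by
  have key : 3 * Real.log 3 + 10 * Real.log 10 ≤ 11 * Real.log 11 := by
    have h := Real.log_le_log (by norm_num : (0 : ℝ) < 3 ^ 3 * 10 ^ 10)
      (by norm_num : (3 : ℝ) ^ 3 * 10 ^ 10 ≤ 11 ^ 11)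
    rw [Real.log_mul (by norm_num) (by norm_num), Real.log_pow, Real.log_pow, Real.log_pow] at h
    push_cast at h
    linarith
  have e0 : (1 : ℝ) / (((11 : ℕ) : ℝ) + 2) = 1 / 13 := by norm_num
  have e2 : (2 * ((1 : ℕ) : ℝ) + 1) / ((((11 : ℕ) : ℝ) + 2) * ((1 : ℕ) : ℝ)) = 3 / 13 := by norm_num
  rw [e0, e2, show (1 : ℝ) - 2 * (1 / 13) = 11 / 13 by norm_num,
    Real.binEntropy_eq_negMulLog_add_negMulLog_one_sub, show (1 : ℝ) - 3 / 13 = 10 / 13 by norm_num]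
  simp only [Real.negMulLog]
  rw [Real.log_div (by norm_num) (by norm_num), Real.log_div (by norm_num) (by norm_num),
    Real.log_div (by norm_num) (by norm_num), Real.log_div (by norm_num) (by norm_num), Real.log_one]
  linarith

/-- **`T(1/2, 9/2)`: `ω(1, 1/2, 9/2) ≤ 11/2`** — the first-power `CW_11` laser method with the X-perfect joint
type `(2,1,9,1)/13` (`tight_cwFamily 11 1 9`). [cite: AlmanDuanVassilevskaWilliamsXuXuZhou2025, Thm. 3.2]
[cite: LeGall2014, Appendix A] [cite: CoppersmithWinograd1990, §6] -/
theorem tight_half_nineHalves : omegaRect ℂ 1 (1 / 2) (9 / 2) ≤ 1 + 9 / 2 := by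
  have h := tight_cwFamily 11 1 9 (by norm_num) le_rfl (by norm_num) entropyCondition_eleven
  have e1 : ((1 : ℕ) : ℝ) / (((1 : ℕ) : ℝ) + 1) = 1 / 2 := by norm_num
  have e9 : ((9 : ℕ) : ℝ) / (((1 : ℕ) : ℝ) + 1) = 9 / 2 := by norm_num
  rw [e1, e9] at h
  exact h

/-- **`ω(2, 1, 9) = 11`: `⟨n², n, n⁹⟩` is exactly tight** (homogeneity, and the information bound
`ω(2,1,9) ≥ 2 + 9`). [cite: LottiRomani1983, §1 (p. 173)] [cite: HuangPan1998, §2 eq. (2.8) (p. 262)] -/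
theorem omegaRect_two_one_nine : omegaRect ℂ 2 1 9 = 11 := by
  refine le_antisymm ?_ (by have h := add_le_omegaRect₁₃ ℂ 2 1 9; linarith)
  have hhom := LottiRomani1983_homogeneous ℂ (by norm_num : (0 : ℝ) ≤ 2) zero_le_one
    (by norm_num : (0 : ℝ) ≤ 1 / 2) (by norm_num : (0 : ℝ) ≤ 9 / 2)
  rw [show (2 : ℝ) * 1 = 2 by norm_num, show (2 : ℝ) * (1 / 2) = 1 by norm_num,
    show (2 : ℝ) * (9 / 2) = 9 by norm_num] at hhom
  rw [hhom]
  linarith [tight_half_nineHalves]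

/-! ## §5 The frontier of the `E₂`-chord ladder -/

/-- **FRONTIER**: under `α ≥ 0.321334` (VXXZ 2024, named fact) the chord rungs `R_t : ω(1,t,1+t) ≤ 2 + t`
hold for every `0 ≤ t ≤ 0.3386` — on `[0, 0.321334]` from the `α`-zone, beyond it from the anchor
`(0.321334, 1)` and the exact point `(1/2, 9/2)` by convexity (slope `7/(2·0.178666) = 19.59`; the method's
exact supremum is `0.321334·s/(s−1) = 0.338619…`).  Beyond `0.3386` every rung is open.
[cite: VassilevskaWilliamsXuXuZhou2024, Abstract] [cite: LottiRomani1983, §1 (p. 173)] -/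
theorem chordRung_frontier (hα : vxxz2024_alpha_ge) {t : ℝ} (ht0 : 0 ≤ t) (ht : t ≤ 0.3386) :
    omegaRect ℂ 1 t (1 + t) ≤ 2 + t := by
  rcases le_or_gt t 0.321334 with hle | hgt
  · have h1 := chord_of_thin_one ht0 zero_le_one (hα.omegaRect_eq_two hle).le
    simpa only [one_mul] using h1
  · have hanchor : omegaRect ℂ 1 0.321334 1 ≤ 2 := (hα.omegaRect_eq_two le_rfl).le
    exact chordRung_of_anchor (by norm_num) hanchor (by norm_num : (0.321334 : ℝ) < 1 / 2) (by norm_num)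
      tight_half_nineHalves hgt.le (by linarith) (by linarith)

/-- **Corollary: `ω(3, 1, 4) = 7` — `⟨n³, n, n⁴⟩ is exactly tight, given `α ≥ 0.321334`** (the rung
`R_{1/3} = T(1/3, 4/3)` of the frontier, homogeneity `×3`, information bound `ω(3,1,4) ≥ 3 + 4`).
(Unconditionally this is the level-1 X-perfect `CW_7` certificate of type `(4,1,3,1)/9`, `7⁷ ≥ 4⁴·5⁵`, not
typed here.) [cite: VassilevskaWilliamsXuXuZhou2024, Abstract] [cite: LottiRomani1983, §1 (p. 173)] -/
theorem omegaRect_three_one_four (hα : vxxz2024_alpha_ge) : omegaRect ℂ 3 1 4 = 7 := by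
  refine le_antisymm ?_ (by have h := add_le_omegaRect₁₃ ℂ 3 1 4; linarith)
  have hR := chordRung_frontier hα (by norm_num : (0 : ℝ) ≤ 1 / 3) (by norm_num)
  have hhom := LottiRomani1983_homogeneous ℂ (by norm_num : (0 : ℝ) ≤ 3) zero_le_one
    (by norm_num : (0 : ℝ) ≤ 1 / 3) (by norm_num : (0 : ℝ) ≤ 1 + 1 / 3)
  rw [show (3 : ℝ) * 1 = 3 by norm_num, show (3 : ℝ) * (1 / 3) = 1 by norm_num,
    show (3 : ℝ) * (1 + 1 / 3) = 4 by norm_num] at hhom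
  rw [hhom]
  linarith

/-! ## §6 Prices of a chord rung (lens 2's fold, cited) and the consequence-free window -/

/-- **Prices of `R_t`** (`t ≥ 0`): `α ≥ 2t/(2+t)` and `ω ≤ 3(2+t)/(2+2t)` — the `α`-fold and the
symmetrisation of the tight shape `(1, t, 1+t)` (`FarEdgeDescentCornerFold.tight_fold`, `omega_le_tight`).
[cite: LeGall2012, §1] [cite: Blaser2013, Theorem 5.9] -/
theorem chordRung_prices {t : ℝ} (ht : 0 ≤ t) (h : omegaRect ℂ 1 t (1 + t) ≤ 2 + t) :
    2 * t / (2 + t) ≤ dualExponentAlpha ℂ ∧ omega ℂ ≤ 3 * (2 + t) / (2 + 2 * t) := by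
  have h' : omegaRect ℂ 1 t (1 + t) ≤ 1 + (1 + t) := by linarith
  refine ⟨?_, ?_⟩
  · have h1 := tight_fold ht (by linarith) h'
    rwa [show (1 : ℝ) + (1 + t) = 2 + t by ring] at h1
  · have h1 := omega_le_tight ht (by linarith) h'
    rwa [show (1 : ℝ) + (1 + t) = 2 + t by ring, show (1 : ℝ) + t + (1 + t) = 2 + 2 * t by ring] at h1

/-- **The proved range is consequence-free**: at its top `t = 0.3386` the `α`-price `2t/(2+t)` is still below
the record `0.321334` (it crosses at `t = 0.38284…`; the `ω`-price crosses `2.371552` only at `t = 0.7216…`).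
[cite: VassilevskaWilliamsXuXuZhou2024, Abstract] -/
theorem alphaPrice_top_lt_record : 2 * (0.3386 : ℝ) / (2 + 0.3386) < 0.321334 := by norm_num

/-- … while the next grades are not: `R_t` with `t ≥ 0.3829` would already improve the `α`-record.
[cite: VassilevskaWilliamsXuXuZhou2024, Abstract] -/
theorem alphaPrice_gt_record {t : ℝ} (ht : 0.3829 ≤ t) : 0.321334 < 2 * t / (2 + t) := by
  rw [lt_div_iff₀ (by linarith)]
  linarith

end Summit.MatrixMultiplication.MatrixMultiplication.Theorems.SaturationLadderChordLadder

end
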